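/- LEAD seat `ym-line-cbag-p1` (prover-ym-line-cbag-p1-g23-0) leading LINE 7 `GlueballBandRecursion`, crux `OneGlueballBandDichotomy`
(stmt-QuantumFields-27554): the ENDGAME of the open stub `stub_bandLevels` in abstract form (blueprint §1, evidence
`blueprint-stub_bandLevels.md` on the item): quadratic flatness of a band top at the LATTICE argmax from a symmetric second-difference
bound, with NO genericity / analyticity-of-branches assumption.  Route-independent; pure real analysis + torus bookkeeping. -/
import Summits.QuantumFields.YangMills.Theorems.GlueballBandRecursionOneGlueballBandLowerDefs

/-!
# Route `GlueballBandRecursion`, crux `OneGlueballBandDichotomy` (stmt-QuantumFields-27554): the band top is quadratically flat at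
# the lattice argmax (where the constant `κ` of `stub_bandLevels` comes from)

Setting (the one-particle endgame, blueprint §1/(P2)).  A prover of `stub_bandLevels` ends up with: a `2π`-periodic real function `g`
on `ℝ³` (the Rayleigh quotient `q ↦ ⟪u, h(q) u⟫` of ONE unit vector against the Bloch symbol `h` of the effective one-particle operator
— a trigonometric polynomial) with a uniform second-difference bound `g(x+v) + g(x−v) ≥ 2g(x) − K|v|²` (`K = sup ‖∂²h‖`); the top levels
`e(p)` of the momentum sectors `p ∈ (Fin N)³` (log-eigenvalues), dominating `g` at the lattice angles `θ(p) = 2πp/N` (variational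
principle), with equality at the lattice argmax `p₀` (choice of `u`).  CONCLUSION (`bandTop_flat_at_latticeArgmax`):
`e(p₀) − e(p) ≤ K·(2π/N)²·momSq N (p − p₀)` for EVERY lattice momentum `p` — i.e. `μ_p ≥ λ₁·exp(−κ·momSq(p − p₀)/N²)` with
`κ = 4π²K` after exponentiating, the shape of `stub_bandLevels`.  The route text's failure mode "non-analytic dispersion `|p|^s`,
`s < 2` / quadratic-or-flatter bottom needed" is thereby EXCLUDED: no non-degeneracy, no analyticity of eigenvalue branches (only
Lipschitz at crossings), no cubic symmetry and no knowledge of where the maximum sits is used — only that `p₀` maximises over the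
LATTICE, which is symmetric under `p ↦ 2p₀ − p`.
Proof: with `v` the shortest torus vector from `θ(p₀)` to `θ(p)` (`|v|² = (2π/N)²·momSq N (p − p₀)`, built from the signed
representatives `signedRep` of the coordinates of `p − p₀`), periodicity gives `g(θ p) = g(θ p₀ + v)` and `g(θ(2p₀ − p)) = g(θ p₀ − v)`,
so `2e(p₀) − K|v|² ≤ 2g(θp₀) − K|v|² ≤ g(θp₀ + v) + g(θp₀ − v) ≤ e(p) + e(2p₀ − p) ≤ e(p) + e(p₀)`.

Objects (small defs, reviewed): `coordsF p = ![p.1, p.2.1, p.2.2]`, `latticeAngle N p = (2π/N)·coordsF p` (as reals),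
`signedRep N d ∈ ℤ` (the representative of `d : Fin N` of least absolute value, `signedRep² = min(d, N−d)²`).

HONEST FRAMING.  This is conditional plumbing for the XL stub (it consumes the one-particle theorem's outputs); nothing about the crux, the
rung `ColdDoublingRecursionStrongCoupling` or the Yang–Mills mass gap is proved here.
-/

set_option autoImplicit false

noncomputable section

open Real Finset

namespace Summit.QuantumFields.YangMills.Theorems.GlueballBandRecursion.Band

variable {N : ℕ}

/-! ### Torus bookkeeping: coordinates, lattice angles, signed representatives -/

/-- The three coordinates of a torus momentum `p ∈ (Fin N)³` as a `Fin 3`-indexed vector. -/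
def coordsF (p : Fin N × Fin N × Fin N) : Fin 3 → Fin N := ![p.1, p.2.1, p.2.2]

/-- `coordsF` is additive. -/
theorem coordsF_add (p q : Fin N × Fin N × Fin N) : coordsF (p + q) = coordsF p + coordsF q := by
  funext i
  fin_cases i <;> rfl

/-- `coordsF` respects subtraction. -/
theorem coordsF_sub (p q : Fin N × Fin N × Fin N) : coordsF (p - q) = coordsF p - coordsF q := by
  funext i
  fin_cases i <;> rfl

/-- `momSq` as a sum over the three coordinates: `momSq N d = Σᵢ min(dᵢ, N − dᵢ)²`. -/
theorem momSq_eq_sum (d : Fin N × Fin N × Fin N) :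
    (momSq N d : ℝ) = ∑ i : Fin 3, ((min (coordsF d i).val (N - (coordsF d i).val) : ℕ) : ℝ) ^ 2 := by
  rw [Fin.sum_univ_three]
  simp [momSq, coordsF]

/-- The lattice angle `θ(p) = (2π/N)·p ∈ ℝ³` of a torus momentum `p ∈ (Fin N)³` (coordinates in `[0, 2π)`). -/
def latticeAngle (N : ℕ) (p : Fin N × Fin N × Fin N) : Fin 3 → ℝ :=
  fun i => 2 * π / N * ((coordsF p i).val : ℝ)

/-- The signed representative of `d : Fin N` of least absolute value: `d` if `d ≤ N − d`, else `d − N`. -/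
def signedRep (N : ℕ) (d : Fin N) : ℤ :=
  if d.val ≤ N - d.val then (d.val : ℤ) else (d.val : ℤ) - N

/-- `signedRep N d ≡ d (mod N)`, with quotient `0` or `1`: `d = signedRep N d + N·b`. -/
theorem exists_val_eq_signedRep_add (d : Fin N) : ∃ b : ℤ, (d.val : ℤ) = signedRep N d + N * b := by
  unfold signedRep
  split_ifs
  · exact ⟨0, by ring⟩
  · exact ⟨1, by ring⟩

/-- `(signedRep N d)² = min(d, N − d)²` — the squared torus distance of `d` from `0`. -/
theorem signedRep_sq (d : Fin N) : ((signedRep N d : ℤ) : ℝ) ^ 2 = ((min d.val (N - d.val) : ℕ) : ℝ) ^ 2 := by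
  unfold signedRep
  have hd : d.val < N := d.isLt
  split_ifs with h
  · rw [min_eq_left h]
    push_cast
    ring
  · rw [min_eq_right (le_of_lt (not_le.1 h))]
    push_cast
    rw [Nat.cast_sub hd.le]
    ring

/-- One coordinate, sum: `θ(a + d) = θ(a) + (2π/N)·signedRep d + 2π z` for some integer `z`. -/
theorem exists_angle_add (hN : 0 < N) (a d : Fin N) : ∃ z : ℤ,
    2 * π / N * (((a + d : Fin N)).val : ℝ) = 2 * π / N * (a.val : ℝ) + 2 * π / N * (signedRep N d : ℝ) + 2 * π * z := by
  obtain ⟨b, hb⟩ := exists_val_eq_signedRep_add d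
  have hNr : (N : ℝ) ≠ 0 := by exact_mod_cast hN.ne'
  -- `(a + d).val + N·q = a.val + d.val` with `q = (a.val + d.val) / N`
  obtain ⟨q, hq⟩ : ∃ q : ℕ, (a + d : Fin N).val + N * q = a.val + d.val :=
    ⟨(a.val + d.val) / N, by rw [Fin.val_add]; exact Nat.mod_add_div _ _⟩
  have hmodr : (((a + d : Fin N).val : ℝ)) = (a.val : ℝ) + d.val - (N : ℝ) * q := by
    have h : (((a + d : Fin N).val : ℝ)) + (N : ℝ) * q = (a.val : ℝ) + d.val := by exact_mod_cast hq
    linarith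
  have hbr : ((d.val : ℝ)) = (signedRep N d : ℝ) + N * b := by exact_mod_cast hb
  refine ⟨b - q, ?_⟩
  rw [hmodr, hbr]
  push_cast
  field_simp
  ring

/-- One coordinate, difference: `θ(a − d) = θ(a) − (2π/N)·signedRep d + 2π z` for some integer `z`. -/
theorem exists_angle_sub (hN : 0 < N) (a d : Fin N) : ∃ z : ℤ,
    2 * π / N * (((a - d : Fin N)).val : ℝ) = 2 * π / N * (a.val : ℝ) - 2 * π / N * (signedRep N d : ℝ) + 2 * π * z := by
  obtain ⟨b, hb⟩ := exists_val_eq_signedRep_add d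
  have hNr : (N : ℝ) ≠ 0 := by exact_mod_cast hN.ne'
  have hd : d.val ≤ N := d.isLt.le
  -- `(a − d).val + N·q = (N − d.val) + a.val` with `q = ((N − d.val) + a.val) / N`
  obtain ⟨q, hq⟩ : ∃ q : ℕ, (a - d : Fin N).val + N * q = (N - d.val) + a.val :=
    ⟨((N - d.val) + a.val) / N, by rw [Fin.val_sub]; exact Nat.mod_add_div _ _⟩
  have hmodr : (((a - d : Fin N).val : ℝ)) = (N : ℝ) - d.val + a.val - (N : ℝ) * q := by
    have h : (((a - d : Fin N).val : ℝ)) + (N : ℝ) * q = ((N - d.val : ℕ) : ℝ) + a.val := by exact_mod_cast hq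
    rw [Nat.cast_sub hd] at h
    linarith
  have hbr : ((d.val : ℝ)) = (signedRep N d : ℝ) + N * b := by exact_mod_cast hb
  refine ⟨1 - b - q, ?_⟩
  rw [hmodr, hbr]
  push_cast
  field_simp
  ring

/-! ### The flatness theorem -/

/-- **The band top is quadratically flat at the lattice argmax.**  Let `g : ℝ³ → ℝ` be `2π`-periodic with the symmetric
second-difference bound `2g(x) − K|v|² ≤ g(x+v) + g(x−v)`; let `e : (Fin N)³ → ℝ` dominate `g` at the lattice angles, `g(θ p) ≤ e p`,
with `e p₀ ≤ g(θ p₀)` at a lattice maximiser `p₀` of `e`.  Then for every lattice momentum `p`: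
`e p₀ − e p ≤ K·(2π/N)²·momSq N (p − p₀)`.  (Blueprint §1 for `stub_bandLevels`: `e = log` of the sector-top eigenvalues, `g` the
Rayleigh quotient of the top eigenvector at `p₀` against the Bloch symbol; gives `μ_p ≥ λ₁ e^{−κ momSq/N²}` with `κ = 4π²K`.) -/
theorem bandTop_flat_at_latticeArgmax [NeZero N] {K : ℝ} (g : (Fin 3 → ℝ) → ℝ)
    (hper : ∀ (x : Fin 3 → ℝ) (z : Fin 3 → ℤ), g (fun i => x i + 2 * π * z i) = g x)
    (hsd : ∀ x v : Fin 3 → ℝ, 2 * g x - K * ∑ i, v i ^ 2 ≤ g (x + v) + g (x - v))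
    (e : Fin N × Fin N × Fin N → ℝ) (hdom : ∀ p, g (latticeAngle N p) ≤ e p)
    (p₀ : Fin N × Fin N × Fin N) (htop : e p₀ ≤ g (latticeAngle N p₀)) (hmax : ∀ p, e p ≤ e p₀)
    (p : Fin N × Fin N × Fin N) :
    e p₀ - e p ≤ K * (2 * π / N) ^ 2 * (momSq N (p - p₀) : ℝ) := by
  have hN : 0 < N := Nat.pos_of_ne_zero (NeZero.ne N)
  set d : Fin N × Fin N × Fin N := p - p₀ with hd
  have hp : p = p₀ + d := by rw [hd, add_sub_cancel]
  set p' : Fin N × Fin N × Fin N := p₀ - d with hp'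
  -- the shortest torus vector `v` from `θ p₀` to `θ p`
  set v : Fin 3 → ℝ := fun i => 2 * π / N * (signedRep N (coordsF d i) : ℝ) with hv
  -- `θ p = θ p₀ + v + 2π z`, `θ p' = θ p₀ − v + 2π z'`
  have hz : ∃ z : Fin 3 → ℤ, latticeAngle N p = fun i => (latticeAngle N p₀ + v) i + 2 * π * z i := by
    refine ⟨fun i => Classical.choose (exists_angle_add hN (coordsF p₀ i) (coordsF d i)), funext fun i => ?_⟩
    have h := Classical.choose_spec (exists_angle_add hN (coordsF p₀ i) (coordsF d i))
    simp only [latticeAngle, Pi.add_apply, hv]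
    rw [hp, coordsF_add, Pi.add_apply]
    exact h
  have hz' : ∃ z : Fin 3 → ℤ, latticeAngle N p' = fun i => (latticeAngle N p₀ - v) i + 2 * π * z i := by
    refine ⟨fun i => Classical.choose (exists_angle_sub hN (coordsF p₀ i) (coordsF d i)), funext fun i => ?_⟩
    have h := Classical.choose_spec (exists_angle_sub hN (coordsF p₀ i) (coordsF d i))
    simp only [latticeAngle, Pi.sub_apply, hv]
    rw [hp', coordsF_sub, Pi.sub_apply]
    exact h
  obtain ⟨z, hz⟩ := hz
  obtain ⟨z', hz'⟩ := hz'
  have hgp : g (latticeAngle N p) = g (latticeAngle N p₀ + v) := by rw [hz, hper]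
  have hgp' : g (latticeAngle N p') = g (latticeAngle N p₀ - v) := by rw [hz', hper]
  -- `|v|² = (2π/N)²·momSq N d`
  have hvv : ∑ i, v i ^ 2 = (2 * π / N) ^ 2 * (momSq N d : ℝ) := by
    rw [momSq_eq_sum, Finset.mul_sum]
    refine Finset.sum_congr rfl fun i _ => ?_
    rw [hv, mul_pow, signedRep_sq]
  -- the symmetrisation argument
  have h1 := hsd (latticeAngle N p₀) v
  have h2 : g (latticeAngle N p₀ + v) ≤ e p := hgp ▸ hdom p
  have h3 : g (latticeAngle N p₀ - v) ≤ e p₀ := hgp' ▸ (hdom p').trans (hmax p')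
  rw [hvv] at h1
  nlinarith [h1, h2, h3, htop]

end Summit.QuantumFields.YangMills.Theorems.GlueballBandRecursion.Band

end
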